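import Mathlib
import Summits.KontsevichZagierPeriods.KontsevichZagierPeriods.Theorems.SoloInformedCoonsPlane
import Summits.KontsevichZagierPeriods.KontsevichZagierPeriods.Theorems.SoloInformedChartCell
import Summits.KontsevichZagierPeriods.KontsevichZagierPeriods.Theorems.SoloInformedKZStokesLine
import HarnessLib

/-!
# SoloInformed — the Coons cell in a chart: semialgebraicity and line derivatives on a rational box

File I2c₃ of the (HT) step (`SoloInformedNashHT`) of the solo-informed programme (support for the
Coons cell `soloInformed_kappaPath_coons`, file `SoloInformedCoonsCell`).

Four Nash edges `e_B, e_T, e_L, e_R` (Nash on `(−ε, 1+ε)`) in one chart `c`; `H` the Coons patch of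
their chart coordinates, viewed on the rational box `W = (−δ, 1+δ)²`, `δ < ε`, with `H(W̄) ⊆ B`.
* `H, Hₛ, Hₜ, Hₛₜ` are continuous on `W` and `H` is `ℚ`-semialgebraic there;
* `H([0,1]²) ⊆ B` when the edges run in the core of `c` on `[0,1]`;
* the coordinates `φⱼ = ψⱼ ∘ H` are `ℚ`-semialgebraic on `W` (`soloInformed_reImSA_chart` with a
  semialgebraic window around the compact `ψ(H(W̄))`, `soloInformed_exists_window`);
* `∂ₛφⱼ = ψⱼ′(H) Hₛ`, `∂ₜφⱼ = ψⱼ′(H) Hₜ` as line derivatives, hence `ℚ`-semialgebraic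
  (`soloInformed_sa_lineDeriv`), and so are `P = Σⱼ ωⱼ(φ) ∂ₛφⱼ`, `Q = Σⱼ ωⱼ(φ) ∂ₜφⱼ`
  (`soloInformed_reImSA_cellPQ`).

References: Huber–Wüstholz, *Transcendence and linear relations of 1-periods* (2022), §7.2;
Bochnak–Coste–Roy, *Real algebraic geometry* (1998), §2.2, Prop. 2.9.1, Prop. 8.1.8.
-/

noncomputable section

open scoped BigOperators Topology
open Set Metric MvPolynomial
open Literature.NumberTheory.Transcendental Literature.NumberTheory.Transcendental.KZ
open Literature.NumberTheory.Transcendental.CurvePeriods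
open Literature.ModelTheory.ExponentialFields

namespace Summit.KontsevichZagierPeriods.KontsevichZagierPeriods.Theorems

variable {Z : CurveData}

/-! ## 5. The cell in the chart: analysis on a rational box -/

section Cell

variable {c : SoloInformedChart Z} {ω : Fin Z.n → MvPolynomial (Fin Z.n) ℂ}
  {eB eT eL eR : ℝ → Fin Z.n → ℂ} {ε δ : ℚ}

/-- Coordinates of points of the box `(−δ, 1 + δ)²` lie in the Nash interval (`δ ≤ ε`). -/
private theorem cell_coord_mem (hδε : δ ≤ ε) {z : Fin 2 → ℝ}
    (hz : z ∈ soloInformedUBox 2 (δ : ℝ)) (i : Fin 2) : z i ∈ Ioo (-(ε : ℝ)) (1 + ε) :=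
  soloInformed_apply_mem_Ioo_of_mem_ubox (by exact_mod_cast hδε) hz i

/-- `h` is continuous on the box `(−ε, 1 + ε)²`. -/
theorem soloInformed_continuousOn_cellH (nB : SoloInformedNashOn ε eB)
    (nT : SoloInformedNashOn ε eT) (nL : SoloInformedNashOn ε eL) (nR : SoloInformedNashOn ε eR)
    (hδε : δ ≤ ε) :
    ContinuousOn (soloInformedCellH c.i₀ eB eT eL eR) (soloInformedUBox 2 (δ : ℝ)) :=
  soloInformed_continuousOn_coons₂ (fun _ hz => cell_coord_mem hδε hz 0)
    (fun _ hz => cell_coord_mem hδε hz 1) (soloInformed_continuousOn_EC nB)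
    (soloInformed_continuousOn_EC nT) (soloInformed_continuousOn_EC nL)
    (soloInformed_continuousOn_EC nR)

/-- `∂ₛh` is continuous on the box. -/
theorem soloInformed_continuousOn_cellDs (nB : SoloInformedNashOn ε eB)
    (nT : SoloInformedNashOn ε eT) (nL : SoloInformedNashOn ε eL) (nR : SoloInformedNashOn ε eR)
    (hδε : δ ≤ ε) :
    ContinuousOn (soloInformedCellDs c.i₀ eB eT eL eR) (soloInformedUBox 2 (δ : ℝ)) :=
  soloInformed_continuousOn_coonsDs₂ (fun _ hz => cell_coord_mem hδε hz 0)
    (fun _ hz => cell_coord_mem hδε hz 1) (soloInformed_continuousOn_EC nL)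
    (soloInformed_continuousOn_EC nR) (soloInformed_continuousOn_ED nB)
    (soloInformed_continuousOn_ED nT)

/-- `∂ₜh` is continuous on the box. -/
theorem soloInformed_continuousOn_cellDt (nB : SoloInformedNashOn ε eB)
    (nT : SoloInformedNashOn ε eT) (nL : SoloInformedNashOn ε eL) (nR : SoloInformedNashOn ε eR)
    (hδε : δ ≤ ε) :
    ContinuousOn (soloInformedCellDt c.i₀ eB eT eL eR) (soloInformedUBox 2 (δ : ℝ)) :=
  soloInformed_continuousOn_coonsDt₂ (fun _ hz => cell_coord_mem hδε hz 0)
    (fun _ hz => cell_coord_mem hδε hz 1) (soloInformed_continuousOn_EC nB)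
    (soloInformed_continuousOn_EC nT) (soloInformed_continuousOn_ED nL)
    (soloInformed_continuousOn_ED nR)

/-- `∂ₜ∂ₛh` is continuous on the box. -/
theorem soloInformed_continuousOn_cellDst (nB : SoloInformedNashOn ε eB)
    (nT : SoloInformedNashOn ε eT) (nL : SoloInformedNashOn ε eL) (nR : SoloInformedNashOn ε eR)
    (hδε : δ ≤ ε) :
    ContinuousOn (soloInformedCellDst c.i₀ eB eT eL eR) (soloInformedUBox 2 (δ : ℝ)) :=
  soloInformed_continuousOn_coonsDst₂ (fun _ hz => cell_coord_mem hδε hz 0)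
    (fun _ hz => cell_coord_mem hδε hz 1) (soloInformed_continuousOn_ED nB)
    (soloInformed_continuousOn_ED nT) (soloInformed_continuousOn_ED nL)
    (soloInformed_continuousOn_ED nR)

/-- **`h` is `ReImSA` on the rational box** `(−δ, 1 + δ)²`, `0 < δ ≤ ε`. -/
theorem soloInformed_reImSA_cellH (hε : 0 < ε) (nB : SoloInformedNashOn ε eB)
    (nT : SoloInformedNashOn ε eT) (nL : SoloInformedNashOn ε eL) (nR : SoloInformedNashOn ε eR)
    (hδε : δ ≤ ε) :
    SoloInformedReImSA (soloInformedUBox 2 (δ : ℝ)) (soloInformedCellH c.i₀ eB eT eL eR) := by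
  have hs := soloInformed_isSemialgebraic_ubox 2 δ
  have h0I : (0 : ℝ) ∈ Icc (0 : ℝ) 1 := ⟨le_rfl, zero_le_one⟩
  have h1I : (1 : ℝ) ∈ Icc (0 : ℝ) 1 := ⟨zero_le_one, le_rfl⟩
  exact soloInformed_reImSA_coons₂ (S := soloInformedIoo1 (-(ε : ℝ)) (1 + ε)) hs
    (fun _ hz => cell_coord_mem hδε hz 0)
    (fun _ hz => cell_coord_mem hδε hz 1) (soloInformed_reImSA_EC nB) (soloInformed_reImSA_EC nT)
    (soloInformed_reImSA_EC nL) (soloInformed_reImSA_EC nR)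
    ((nB.isNashPath hε).isAlgebraic_apply h0I isAlgebraic_zero c.i₀)
    ((nB.isNashPath hε).isAlgebraic_apply h1I isAlgebraic_one c.i₀)
    ((nT.isNashPath hε).isAlgebraic_apply h0I isAlgebraic_zero c.i₀)
    ((nT.isNashPath hε).isAlgebraic_apply h1I isAlgebraic_one c.i₀)

/-- **`h` maps `[0,1]²` into the disc `B`** (indeed into `ball w₀ (3ε/4)`), when the four edges
run in the core of the chart on `[0,1]`. -/
theorem soloInformed_cellH_mem_ball (hBm : ∀ u ∈ Icc (0 : ℝ) 1, eB u ∈ soloInformedCore c)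
    (hTm : ∀ u ∈ Icc (0 : ℝ) 1, eT u ∈ soloInformedCore c)
    (hLm : ∀ u ∈ Icc (0 : ℝ) 1, eL u ∈ soloInformedCore c)
    (hRm : ∀ u ∈ Icc (0 : ℝ) 1, eR u ∈ soloInformedCore c) {z : Fin 2 → ℝ}
    (hz : z ∈ soloInformedCube 2) : soloInformedCellH c.i₀ eB eT eL eR z ∈ ball c.w₀ c.ε := by
  have h0I : (0 : ℝ) ∈ Icc (0 : ℝ) 1 := ⟨le_rfl, zero_le_one⟩
  have h1I : (1 : ℝ) ∈ Icc (0 : ℝ) 1 := ⟨zero_le_one, le_rfl⟩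
  have hs : z 0 ∈ Icc (0 : ℝ) 1 := ⟨(hz 0).1, (hz 0).2⟩
  have ht : z 1 ∈ Icc (0 : ℝ) 1 := ⟨(hz 1).1, (hz 1).2⟩
  have hε : 0 < c.ε := c.eps_pos_of_mem_core (hBm 0 h0I)
  have key := soloInformed_norm_coons_sub_le (cB := soloInformedEC c.i₀ eB)
    (cT := soloInformedEC c.i₀ eT) (cL := soloInformedEC c.i₀ eL) (cR := soloInformedEC c.i₀ eR)
    hs ht (c.norm_coord_sub_le_of_mem_core (hBm _ hs)) (c.norm_coord_sub_le_of_mem_core (hTm _ hs))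
    (c.norm_coord_sub_le_of_mem_core (hLm _ ht)) (c.norm_coord_sub_le_of_mem_core (hRm _ ht))
    (c.norm_coord_sub_le_of_mem_core (hBm _ h0I)) (c.norm_coord_sub_le_of_mem_core (hBm _ h1I))
    (c.norm_coord_sub_le_of_mem_core (hTm _ h0I)) (c.norm_coord_sub_le_of_mem_core (hTm _ h1I))
  rw [mem_ball_iff_norm]
  exact lt_of_le_of_lt key (by linarith)

/-- **Window.**  If `h` maps the closed box `[−δ, 1 + δ]²` into `B`, there is a `ℚ`-semialgebraic
window `Wn`, `ψ(h([−δ, 1 + δ]²)) ⊆ Wn ⊆ Ω`. -/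
theorem soloInformed_exists_cellWindow (nB : SoloInformedNashOn ε eB)
    (nT : SoloInformedNashOn ε eT) (nL : SoloInformedNashOn ε eL) (nR : SoloInformedNashOn ε eR)
    (hδε : δ < ε)
    (hδ : ∀ z ∈ soloInformedCBox 2 (δ : ℝ), soloInformedCellH c.i₀ eB eT eL eR z ∈ ball c.w₀ c.ε) :
    ∃ Wn : Set (Fin Z.n → ℂ),
      c.ψ '' (soloInformedCellH c.i₀ eB eT eL eR '' soloInformedCBox 2 (δ : ℝ)) ⊆ Wn ∧ Wn ⊆ c.Ω ∧
        IsSemialgebraic ℚ {x | soloInformedCx Z.n x ∈ Wn} := by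
  have hcont : ContinuousOn (soloInformedCellH c.i₀ eB eT eL eR) (soloInformedCBox 2 (δ : ℝ)) :=
    (soloInformed_continuousOn_cellH nB nT nL nR le_rfl).mono
      (soloInformed_cbox_subset_ubox 2 (by exact_mod_cast hδε))
  have hK₁ : IsCompact (soloInformedCellH c.i₀ eB eT eL eR '' soloInformedCBox 2 (δ : ℝ)) :=
    (soloInformed_isCompact_cbox 2 δ).image_of_continuousOn hcont
  have hK₁B : soloInformedCellH c.i₀ eB eT eL eR '' soloInformedCBox 2 (δ : ℝ) ⊆ ball c.w₀ c.ε := by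
    rintro _ ⟨z, hz, rfl⟩
    exact hδ z hz
  have hK : IsCompact (c.ψ '' (soloInformedCellH c.i₀ eB eT eL eR '' soloInformedCBox 2 (δ : ℝ))) :=
    hK₁.image_of_continuousOn (c.continuousOn.mono hK₁B)
  have hKΩ : c.ψ '' (soloInformedCellH c.i₀ eB eT eL eR '' soloInformedCBox 2 (δ : ℝ)) ⊆ c.Ω := by
    rintro _ ⟨w, hw, rfl⟩
    exact (c.right_inv w (hK₁B hw)).1
  exact soloInformed_exists_window hK c.isOpen hKΩ

/-- **The chart coordinates `φⱼ = ψⱼ ∘ h` are `ReImSA` on the rational box.**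
[BCR 1998, Prop. 8.1.8; Huber–Wüstholz 2022, §3.3.1] -/
theorem soloInformed_reImSA_cellPhi (hZ : Z.IsSmoothAffineCurve) (hε : 0 < ε)
    (nB : SoloInformedNashOn ε eB) (nT : SoloInformedNashOn ε eT) (nL : SoloInformedNashOn ε eL)
    (nR : SoloInformedNashOn ε eR) (hδε : δ < ε)
    (hδ : ∀ z ∈ soloInformedCBox 2 (δ : ℝ), soloInformedCellH c.i₀ eB eT eL eR z ∈ ball c.w₀ c.ε)
    (j : Fin Z.n) :
    SoloInformedReImSA (soloInformedUBox 2 (δ : ℝ))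
      (fun z => c.ψ (soloInformedCellH c.i₀ eB eT eL eR z) j) := by
  obtain ⟨Wn, hKW, hWΩ, hWs⟩ := soloInformed_exists_cellWindow nB nT nL nR hδε hδ
  have hsub := soloInformed_ubox_subset_cbox 2 (δ : ℝ)
  exact soloInformed_reImSA_chart c.left_inv c.right_inv hWΩ (fun z hz => hδ z (hsub hz))
    (fun z hz => hKW ⟨_, ⟨z, hsub hz, rfl⟩, rfl⟩) hZ.algebraic hWs
    (soloInformed_isSemialgebraic_ubox 2 δ) (soloInformed_reImSA_cellH hε nB nT nL nR hδε.le) j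

/-- The derivative of the chart form at a point of `B`. -/
private theorem cell_hasDerivAt_G {w : ℂ} (hw : w ∈ ball c.w₀ c.ε) :
    HasDerivAt (soloInformedChartForm c ω) (deriv (soloInformedChartForm c ω) w) w :=
  ((soloInformed_analyticOnNhd_chartForm c ω) w hw).differentiableAt.hasDerivAt

/-- **Line derivative of `φⱼ` along `e₀`**: `∂ₛφⱼ = ψⱼ′(h) ∂ₛh`, for any real-linear read-out
`L` (`Re` or `Im`). -/
theorem soloInformed_hasLineDerivAt_cellPhi_s (nB : SoloInformedNashOn ε eB)
    (nT : SoloInformedNashOn ε eT) (hδε : δ ≤ ε) {z : Fin 2 → ℝ}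
    (hz : z ∈ soloInformedUBox 2 (δ : ℝ))
    (hHz : soloInformedCellH c.i₀ eB eT eL eR z ∈ ball c.w₀ c.ε) (L : ℂ →L[ℝ] ℝ) (j : Fin Z.n) :
    HasLineDerivAt ℝ (fun w => L (c.ψ (soloInformedCellH c.i₀ eB eT eL eR w) j))
      (L (deriv (fun w => c.ψ w j) (soloInformedCellH c.i₀ eB eT eL eR z) *
        soloInformedCellDs c.i₀ eB eT eL eR z)) z (Pi.single 0 1) := by
  apply soloInformed_hasLineDerivAt_of_update
  have key : (fun u => L (c.ψ (soloInformedCellH c.i₀ eB eT eL eR (Function.update z 0 u)) j)) =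
      fun u => L (c.ψ (soloInformedCoons (soloInformedEC c.i₀ eB) (soloInformedEC c.i₀ eT)
        (soloInformedEC c.i₀ eL) (soloInformedEC c.i₀ eR) u (z 1)) j) := by
    ext u
    simp only [soloInformedCellH, Function.update_self,
      Function.update_of_ne (show (1 : Fin 2) ≠ 0 by decide)]
  rw [key]
  have hh := soloInformed_hasDerivAt_coons_s (cL := soloInformedEC c.i₀ eL)
    (cR := soloInformedEC c.i₀ eR) (z 1) (soloInformed_hasDerivAt_EC (i₀ := c.i₀) nB (cell_coord_mem hδε hz 0))
    (soloInformed_hasDerivAt_EC (i₀ := c.i₀) nT (cell_coord_mem hδε hz 0))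
  have h1 : HasDerivAt (fun u => c.ψ (soloInformedCoons (soloInformedEC c.i₀ eB)
      (soloInformedEC c.i₀ eT) (soloInformedEC c.i₀ eL) (soloInformedEC c.i₀ eR) u (z 1)) j)
      (deriv (fun w => c.ψ w j) (soloInformedCellH c.i₀ eB eT eL eR z) *
        soloInformedCellDs c.i₀ eB eT eL eR z) (z 0) := by
    have hψ : HasDerivAt (fun w => c.ψ w j)
        (deriv (fun w => c.ψ w j) (soloInformedCellH c.i₀ eB eT eL eR z))
        (soloInformedCoons (soloInformedEC c.i₀ eB) (soloInformedEC c.i₀ eT) (soloInformedEC c.i₀ eL)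
          (soloInformedEC c.i₀ eR) (z 0) (z 1)) := c.hasDerivAt_coord hHz j
    exact hψ.comp (z 0) hh
  exact L.hasFDerivAt.comp_hasDerivAt (z 0) h1

/-- **Line derivative of `φⱼ` along `e₁`**: `∂ₜφⱼ = ψⱼ′(h) ∂ₜh`. -/
theorem soloInformed_hasLineDerivAt_cellPhi_t (nL : SoloInformedNashOn ε eL)
    (nR : SoloInformedNashOn ε eR) (hδε : δ ≤ ε) {z : Fin 2 → ℝ}
    (hz : z ∈ soloInformedUBox 2 (δ : ℝ))
    (hHz : soloInformedCellH c.i₀ eB eT eL eR z ∈ ball c.w₀ c.ε) (L : ℂ →L[ℝ] ℝ) (j : Fin Z.n) :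
    HasLineDerivAt ℝ (fun w => L (c.ψ (soloInformedCellH c.i₀ eB eT eL eR w) j))
      (L (deriv (fun w => c.ψ w j) (soloInformedCellH c.i₀ eB eT eL eR z) *
        soloInformedCellDt c.i₀ eB eT eL eR z)) z (Pi.single 1 1) := by
  apply soloInformed_hasLineDerivAt_of_update
  have key : (fun u => L (c.ψ (soloInformedCellH c.i₀ eB eT eL eR (Function.update z 1 u)) j)) =
      fun u => L (c.ψ (soloInformedCoons (soloInformedEC c.i₀ eB) (soloInformedEC c.i₀ eT)
        (soloInformedEC c.i₀ eL) (soloInformedEC c.i₀ eR) (z 0) u) j) := by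
    ext u
    simp only [soloInformedCellH, Function.update_self,
      Function.update_of_ne (show (0 : Fin 2) ≠ 1 by decide)]
  rw [key]
  have hh := soloInformed_hasDerivAt_coons_t (cB := soloInformedEC c.i₀ eB)
    (cT := soloInformedEC c.i₀ eT) (z 0) (soloInformed_hasDerivAt_EC (i₀ := c.i₀) nL (cell_coord_mem hδε hz 1))
    (soloInformed_hasDerivAt_EC (i₀ := c.i₀) nR (cell_coord_mem hδε hz 1))
  have h1 : HasDerivAt (fun u => c.ψ (soloInformedCoons (soloInformedEC c.i₀ eB)
      (soloInformedEC c.i₀ eT) (soloInformedEC c.i₀ eL) (soloInformedEC c.i₀ eR) (z 0) u) j)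
      (deriv (fun w => c.ψ w j) (soloInformedCellH c.i₀ eB eT eL eR z) *
        soloInformedCellDt c.i₀ eB eT eL eR z) (z 1) := by
    have hψ : HasDerivAt (fun w => c.ψ w j)
        (deriv (fun w => c.ψ w j) (soloInformedCellH c.i₀ eB eT eL eR z))
        (soloInformedCoons (soloInformedEC c.i₀ eB) (soloInformedEC c.i₀ eT) (soloInformedEC c.i₀ eL)
          (soloInformedEC c.i₀ eR) (z 0) (z 1)) := c.hasDerivAt_coord hHz j
    exact hψ.comp (z 1) hh
  exact L.hasFDerivAt.comp_hasDerivAt (z 1) h1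

/-- **`G(h) ∂ₛh` and `G(h) ∂ₜh` are `ReImSA` on the rational box**: the heart of the cell lemma.
`G(h) ∂ₛh = Σⱼ ωⱼ(φ) ∂ₛφⱼ` with `φ = ψ ∘ h` `ReImSA` (chart lemma) and `∂ₛφⱼ` `ReImSA` as a line
derivative of a semialgebraic function (`soloInformed_sa_lineDeriv`). [BCR 1998, §2.2, 8.1.8] -/
theorem soloInformed_reImSA_cellPQ (hZ : Z.IsSmoothAffineCurve) (hω : ∀ i, HasAlgCoeffs (ω i))
    (hε : 0 < ε) (nB : SoloInformedNashOn ε eB) (nT : SoloInformedNashOn ε eT)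
    (nL : SoloInformedNashOn ε eL) (nR : SoloInformedNashOn ε eR) (hδε : δ < ε)
    (hδ : ∀ z ∈ soloInformedCBox 2 (δ : ℝ), soloInformedCellH c.i₀ eB eT eL eR z ∈ ball c.w₀ c.ε) :
    SoloInformedReImSA (soloInformedUBox 2 (δ : ℝ)) (soloInformedCellPc c ω eB eT eL eR) ∧
      SoloInformedReImSA (soloInformedUBox 2 (δ : ℝ)) (soloInformedCellQc c ω eB eT eL eR) := by
  have hs := soloInformed_isSemialgebraic_ubox 2 δ
  have hWo := soloInformed_isOpen_ubox 2 (δ : ℝ)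
  have hsub := soloInformed_ubox_subset_cbox 2 (δ : ℝ)
  have hφ : ∀ j, SoloInformedReImSA (soloInformedUBox 2 (δ : ℝ))
      (fun z => c.ψ (soloInformedCellH c.i₀ eB eT eL eR z) j) :=
    soloInformed_reImSA_cellPhi hZ hε nB nT nL nR hδε hδ
  have hΦs : ∀ j, SoloInformedReImSA (soloInformedUBox 2 (δ : ℝ))
      (fun z => deriv (fun w => c.ψ w j) (soloInformedCellH c.i₀ eB eT eL eR z) *
        soloInformedCellDs c.i₀ eB eT eL eR z) := fun j =>
    ⟨soloInformed_sa_lineDeriv hWo (hφ j).1 0 fun z hz => by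
        simpa only [Complex.reCLM_apply] using soloInformed_hasLineDerivAt_cellPhi_s nB nT hδε.le
          hz (hδ z (hsub hz)) Complex.reCLM j,
      soloInformed_sa_lineDeriv hWo (hφ j).2 0 fun z hz => by
        simpa only [Complex.imCLM_apply] using soloInformed_hasLineDerivAt_cellPhi_s nB nT hδε.le
          hz (hδ z (hsub hz)) Complex.imCLM j⟩
  have hΦt : ∀ j, SoloInformedReImSA (soloInformedUBox 2 (δ : ℝ))
      (fun z => deriv (fun w => c.ψ w j) (soloInformedCellH c.i₀ eB eT eL eR z) *
        soloInformedCellDt c.i₀ eB eT eL eR z) := fun j =>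
    ⟨soloInformed_sa_lineDeriv hWo (hφ j).1 1 fun z hz => by
        simpa only [Complex.reCLM_apply] using soloInformed_hasLineDerivAt_cellPhi_t nL nR hδε.le
          hz (hδ z (hsub hz)) Complex.reCLM j,
      soloInformed_sa_lineDeriv hWo (hφ j).2 1 fun z hz => by
        simpa only [Complex.imCLM_apply] using soloInformed_hasLineDerivAt_cellPhi_t nL nR hδε.le
          hz (hδ z (hsub hz)) Complex.imCLM j⟩
  constructor
  · have h := SoloInformedReImSA.sum hs Finset.univ fun j _ =>
      (SoloInformedReImSA.eval_poly hs hφ (hω j)).mul (hΦs j)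
    refine h.congr fun z _ => ?_
    rw [soloInformedCellPc_eq, soloInformedChartForm, Finset.sum_mul]
    exact Finset.sum_congr rfl fun j _ => by ring
  · have h := SoloInformedReImSA.sum hs Finset.univ fun j _ =>
      (SoloInformedReImSA.eval_poly hs hφ (hω j)).mul (hΦt j)
    refine h.congr fun z _ => ?_
    rw [soloInformedCellQc_eq, soloInformedChartForm, Finset.sum_mul]
    exact Finset.sum_congr rfl fun j _ => by ring

end Cell

end Summit.KontsevichZagierPeriods.KontsevichZagierPeriods.Theorems
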